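import Summits.CriticalPhenomena.CardyFormulaZ2.Theorems.CardyComplexConeEdgePrecompactUFRSJunctionFunnelFrame

/-!
# The junction funnel, part E: the funnel for one datum in a rotation frame
(line `qkz-strip-boundary-arm` of crux `CardyComplexCone.EdgePrecompact`, stmt-CriticalPhenomena-11387;
fifth file of the registered sub-goal S2 = `ufrs_junctionFunnel`, lead c5, wave 4; registered
anchor `ref_funnel_JF`; continues `…UFRSJunctionFunnelFrame.lean`)

`ref_funnel_JF` — for `ℤ²`-admissible data `F` of an open rectangle, a rotation frame
`ψ = σ ∘ (· - n)` under which the lattice box of `F` is `[I₀, I₁] × [J₀, J₁]`, and the arch of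
the junction gate READ IN THE FRAME (an `ψ '' ω`-open lattice walk `P` from `v₀` leaving the box,
whose box vertices are off the free arc, and a face walk `Q` from the face of the gate corner
`(v₀, k₀)` to below the box, crossing `ψ '' ω`-closed edges with an endpoint off the wired arc,
in the regions of the gate), every stretch of an orbit of the PHYSICAL successor map
`nextCorner (F.bcBondConfig ω)` through inner faces of `F` joining the sup-ball of radius `2N - 1`
about `n` to sup-distance `≥ M + 2` from `n` visits the physical gate corner `(ψ⁻¹ v₀, k₀ - j)`.
Proof: truncate `P` at its first exit from the box and `Q` at its first non-box face
(`exists_firstExit_JF`), transport the orbit (`cornerOrbit_frame_JF`) and the inner faces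
(`corners_mem_of_isInnerFace_JF`, `refFace_of_corners_JF`), and apply the abstract funnel
`fence_funnel_JF` to `ψ '' (F.bcBondConfig ω)`: box darts of `P` are open after the boundary
condition (edges of `Ω_δ`, `ω`-open, no endpoint on the free arc), edges crossed by `Q` are
closed after it (`ω`-closed and not both endpoints on the wired arc, `mem_bcBondConfig_cases`).

References: S. Smirnov, C. R. Acad. Sci. Paris 333 (2001), §2; H. Kesten, Comm. Math. Phys. 109
(1987), §2.
-/

set_option linter.unusedVariables false

namespace Summit.CriticalPhenomena.CardyFormulaZ2.Cruxes.EdgePrecompact.QkzStripBoundaryArm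

open MeasureTheory Filter Set Metric
open scoped Topology BigOperators Pointwise
open Literature.Probability.LatticeModels Literature.Probability.Percolation
open Literature.Probability.RandomPlanarGeometry (DobrushinDomain)
open Summit.CriticalPhenomena.CardyFormulaZ2.Theses.CardyComplexCone

noncomputable section

/-! ## The funnel in the reference frame -/

/-- The last dart of a walk between distinct vertices. -/
theorem exists_last_dart_JF {V : Type*} {G : SimpleGraph V} {a c : V} (q : G.Walk a c) (h : a ≠ c) :
    ∃ d ∈ q.darts, d.snd = c := by
  have hc := q.end_mem_tail_support_of_ne h
  rw [← SimpleGraph.Walk.map_snd_darts, List.mem_map] at hc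
  exact hc

/-- A support vertex of a walk is a dart source or the last vertex. -/
theorem mem_support_cases_JF {V : Type*} {G : SimpleGraph V} {a c : V} (q : G.Walk a c) {z : V} (hz : z ∈ q.support) :
    (∃ d ∈ q.darts, d.fst = z) ∨ z = c := by
  rw [← SimpleGraph.Walk.map_fst_darts_append, List.mem_append, List.mem_map, List.mem_singleton] at hz
  exact hz

/-- **The funnel for one datum, in a rotation frame.** `ℤ²`-admissible data `F` of an open
rectangle; a rotation frame `ψ = σ ∘ (· - n)` (`hrot`) under which the lattice box of `F` becomes
`[I₀, I₁] × [J₀, J₁]` (`hbox`); a configuration `ω`; the arch of the gate READ IN THE FRAME: a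
lattice walk `P` from `v₀` (in the box, `2N ≤ (v₀)₁`) to a vertex outside the box, with
`ψ '' ω`-open edges, in `{x₁ ≥ 2N} ∪ {|x₀| ≥ 2N}` and in `[-M, M]²`, whose box vertices are not on
the free arc (pulled back by `ψ`); a face walk `Q` from the face of the corner `(v₀, k₀)` (a face
of the box) to a face below the row `J₀`, each step crossing a `ψ '' ω`-closed edge with an
endpoint off the wired arc, in `{x₀ ≥ 2N} ∪ {x₀ + 1 ≤ -2N}`, abscissae inside the box, ordinates
`≤ J₁ - 1`, in `[-M, M]²`; every (outside-the-box vertex of `P`, face of `Q`) pair on opposite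
sides of the inner columns. Then every stretch `[i, j]` of an orbit of the PHYSICAL successor map
`nextCorner (F.bcBondConfig ω)` through inner faces of `F`, with one end vertex within sup-distance
`2N - 1` of `n` and the other at sup-distance `≥ M + 2` from `n`, visits the physical gate corner
`(ψ⁻¹ v₀, k₀ - j)`. Proof: truncate `P` at its first exit from the box and `Q` at its first
non-box face, transport the orbit by `cornerOrbit_frame_JF`, and apply `fence_funnel_JF` to
`ψ '' (F.bcBondConfig ω)` — the box darts of `P` are open after the boundary condition (edges of
`Ω_δ`, `ω`-open, no endpoint on the free arc), the edges crossed by `Q` are closed after it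
(`ω`-closed and not both endpoints on the wired arc). -/
theorem ref_funnel_JF : ∀ (F : DiscreteDobrushin) (x₀ x₁ y₀ y₁ : ℝ), F.IsZdAdmissible → F.Ω = Set.Ioo x₀ x₁ ×ℂ Set.Ioo y₀ y₁ → ∀ (π : Equiv.Perm (Fin 2)) (ε : Fin 2 → ℤˣ) (j : Fin 4) (n : Site 2), (∀ k, Site.signedPerm π ε (cornerUnit k) = cornerUnit (k + j)) → ∀ (I₀ I₁ J₀ J₁ N M : ℤ), J₀ ≤ 2 * N → -M ≤ J₀ → 2 * N ≤ M → M + 1 ≤ J₁ → (∀ z : Site 2, ((zdShiftIso (-n)).trans (zdSignedPermIso π ε)).symm z ∈ meshVertices F.Ω F.δ ↔ (I₀ ≤ z 0 ∧ z 0 ≤ I₁ ∧ J₀ ≤ z 1 ∧ z 1 ≤ J₁)) → ∀ (ω : BondConfig (Site 2)) (v₀ u g : Site 2) (k₀ : Fin 4) (P : (zdGraph 2).Walk v₀ u) (Q : (zdGraph 2).Walk (cFace (v₀, k₀)) g), 2 * N ≤ v₀ 1 → (I₀ ≤ v₀ 0 ∧ v₀ 0 ≤ I₁ ∧ J₀ ≤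 v₀ 1 ∧ v₀ 1 ≤ J₁) → (I₀ ≤ cFace (v₀, k₀) 0 ∧ cFace (v₀, k₀) 0 + 1 ≤ I₁ ∧ J₀ ≤ cFace (v₀, k₀) 1 ∧ cFace (v₀, k₀) 1 + 1 ≤ J₁) → (∀ e ∈ P.edges, e ∈ BondConfig.relabel (sym2Equiv ((zdShiftIso (-n)).trans (zdSignedPermIso π ε)).toEquiv) ω) → (∀ z ∈ P.support, (2 * N ≤ z 1 ∨ 2 * N ≤ z 0 ∨ z 0 ≤ -(2 * N)) ∧ (-M ≤ z 0 ∧ z 0 ≤ M ∧ -M ≤ z 1 ∧ z 1 ≤ M)) → (∀ z ∈ P.support, (I₀ ≤ z 0 ∧ z 0 ≤ I₁ ∧ J₀ ≤ z 1 ∧ z 1 ≤ J₁) → ((zdShiftIso (-n)).trans (zdSignedPermIso π ε)).symm z ∉ F.zdArcB) → ¬ (I₀ ≤ u 0 ∧ u 0 ≤ I₁ ∧ J₀ ≤ u 1 ∧ u 1 ≤ J₁) → (∀ d ∈ Q.darts, sepEdge d.fst d.snd ∉ BondConfig.relabel (sym2Equiv ((zdShiftIso (-n)).trans (zdSignedPermIso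 π ε)).toEquiv) ω) → (∀ f ∈ Q.support, (2 * N ≤ f 0 ∨ f 0 + 1 ≤ -(2 * N)) ∧ (-M ≤ f 0 ∧ f 0 ≤ M ∧ -M ≤ f 1 ∧ f 1 ≤ M) ∧ (I₀ ≤ f 0 ∧ f 0 + 1 ≤ I₁ ∧ f 1 + 1 ≤ J₁)) → (∀ d ∈ Q.darts, ∃ y ∈ sepEdge d.fst d.snd, ((zdShiftIso (-n)).trans (zdSignedPermIso π ε)).symm y ∉ F.zdArcA) → g 1 < J₀ → (∀ z ∈ P.support, ¬ (I₀ ≤ z 0 ∧ z 0 ≤ I₁ ∧ J₀ ≤ z 1 ∧ z 1 ≤ J₁) → ∀ f ∈ Q.support, ∀ X : ℤ, -(4 * N) + 1 ≤ X → X ≤ 4 * N - 2 → 2 * I₀ ≤ X → X + 1 ≤ 2 * I₁ → (X + 1 ≤ 2 * f 0 + 1 ↔ ¬ X + 1 ≤ 2 * z 0)) → ∀ (c : Site 2 × Fin 4) (i j' : ℕ), i ≤ j' → (∀ t, i ≤ t → t ≤ j' → F.IsInnerFace (cFace (cornerOrbit (F.bcBondConfig ω) c t))) → ((-(2 * N -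 1) ≤ ((cornerOrbit (F.bcBondConfig ω) c i).1 - n) 0 ∧ ((cornerOrbit (F.bcBondConfig ω) c i).1 - n) 0 ≤ 2 * N - 1 ∧ -(2 * N - 1) ≤ ((cornerOrbit (F.bcBondConfig ω) c i).1 - n) 1 ∧ ((cornerOrbit (F.bcBondConfig ω) c i).1 - n) 1 ≤ 2 * N - 1) ∧ (M + 2 ≤ |((cornerOrbit (F.bcBondConfig ω) c j').1 - n) 0| ∨ M + 2 ≤ |((cornerOrbit (F.bcBondConfig ω) c j').1 - n) 1|)) ∨ ((M + 2 ≤ |((cornerOrbit (F.bcBondConfig ω) c i).1 - n) 0| ∨ M + 2 ≤ |((cornerOrbit (F.bcBondConfig ω) c i).1 - n) 1|) ∧ (-(2 * N - 1) ≤ ((cornerOrbit (F.bcBondConfig ω) c j').1 - n) 0 ∧ ((cornerOrbit (F.bcBondConfig ω) c j').1 - n) 0 ≤ 2 * N - 1 ∧ -(2 * N - 1) ≤ ((cornerOrbit (F.bcBondConfig ω) c j').1 - n) 1 ∧ ((cornerOrbit (F.bcBondConfig ω) c j').1 - n) 1 ≤ 2 * N - 1)) → ∃ s, i ≤ s ∧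 s ≤ j' ∧ cornerOrbit (F.bcBondConfig ω) c s = (((zdShiftIso (-n)).trans (zdSignedPermIso π ε)).symm v₀, k₀ - j) := by
  intro F x₀ x₁ y₀ y₁ hF hFΩ π ε j n hrot I₀ I₁ J₀ J₁ N M hJN hJM hNM hMJ hbox ω v₀ u g k₀ P Q hv₀ hv₀b hf₀ hPω hPreg hPcol hu hQω hQreg hQcol hg hX c i j' hij hin hends
  set Ψ : zdGraph 2 ≃g zdGraph 2 := (zdShiftIso (-n)).trans (zdSignedPermIso π ε) with hΨ
  set β : BondConfig (Site 2) := BondConfig.relabel (sym2Equiv Ψ.toEquiv) (F.bcBondConfig ω) with hβ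
  have hΨx : ∀ x, Ψ x = Site.signedPerm π ε (x - n) := frame_apply_JF π ε n
  -- truncate the arch at the box
  obtain ⟨p₁, P', hp₁, hP'src, hP'd, hP's⟩ :=
    exists_firstExit_JF (fun z : Site 2 => I₀ ≤ z 0 ∧ z 0 ≤ I₁ ∧ J₀ ≤ z 1 ∧ z 1 ≤ J₁) P hu
  obtain ⟨q₁, Q', hq₁, hQ'src, hQ'd, hQ's⟩ :=
    exists_firstExit_JF (fun f : Site 2 => I₀ ≤ cFace (f, 0) 0 ∧ cFace (f, 0) 0 + 1 ≤ I₁ ∧ J₀ ≤ cFace (f, 0) 1 ∧ cFace (f, 0) 1 + 1 ≤ J₁) Q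
      (by simp [cFace, faceAt]; omega)
  have hface0 : ∀ f : Site 2, cFace (f, 0) = f := fun f => by simp [cFace, faceAt, cornerOff]
  simp only [hface0] at hq₁ hQ'src
  -- the exit vertex of `P` and the exit face of `Q`
  have hp₁ne : v₀ ≠ p₁ := by rintro rfl; exact hp₁ hv₀b
  obtain ⟨dP, hdP, hdP2⟩ := exists_last_dart_JF P' hp₁ne
  have hdP1 := hP'src dP hdP
  have hdPadj := dP.adj
  rw [adj_iff_coord_JF, hdP2] at hdPadj
  have hp₁P : p₁ ∈ P.support := hP's p₁ P'.end_mem_support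
  have hp₁reg := hPreg p₁ hp₁P
  have hp₁y : J₀ - 1 ≤ p₁ 1 ∧ (p₁ 1 < J₀ ∨ p₁ 0 < I₀ ∨ I₁ < p₁ 0) := by
    constructor
    · omega
    · by_contra hcon
      exact hp₁ (by omega)
  have hq₁ne : cFace (v₀, k₀) ≠ q₁ := by rintro h; rw [← h] at hq₁; exact hq₁ hf₀
  obtain ⟨dQ, hdQ, hdQ2⟩ := exists_last_dart_JF Q' hq₁ne
  have hdQ1 := hQ'src dQ hdQ
  have hdQadj := dQ.adj
  rw [adj_iff_coord_JF, hdQ2] at hdQadj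
  have hq₁Q : q₁ ∈ Q.support := hQ's q₁ Q'.end_mem_support
  have hq₁reg := hQreg q₁ hq₁Q
  have hq₁y : q₁ 1 = J₀ - 1 := by omega
  -- the transported orbit
  set cR : Site 2 × Fin 4 := (Site.signedPerm π ε (c.1 - n), c.2 + j) with hcR
  have horb : ∀ t, cornerOrbit β cR t =
      (Site.signedPerm π ε ((cornerOrbit (F.bcBondConfig ω) c t).1 - n), (cornerOrbit (F.bcBondConfig ω) c t).2 + j) :=
    fun t => cornerOrbit_frame_JF π ε j n (F.bcBondConfig ω) c t hrot
  have hboxx : ∀ x : Site 2, x ∈ meshVertices F.Ω F.δ ↔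
      (I₀ ≤ Site.signedPerm π ε (x - n) 0 ∧ Site.signedPerm π ε (x - n) 0 ≤ I₁ ∧
        J₀ ≤ Site.signedPerm π ε (x - n) 1 ∧ Site.signedPerm π ε (x - n) 1 ≤ J₁) := by
    intro x
    rw [← hΨx, ← hbox (Ψ x), RelIso.symm_apply_apply]
  have hinR : ∀ t, i ≤ t → t ≤ j' → I₀ ≤ cFace (cornerOrbit β cR t) 0 ∧ cFace (cornerOrbit β cR t) 0 + 1 ≤ I₁ ∧
      J₀ ≤ cFace (cornerOrbit β cR t) 1 ∧ cFace (cornerOrbit β cR t) 1 + 1 ≤ J₁ := by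
    intro t hit htj
    rw [horb t]
    have h4 := corners_mem_of_isInnerFace_JF hF hFΩ (v := (cornerOrbit (F.bcBondConfig ω) c t).1)
      (k := (cornerOrbit (F.bcBondConfig ω) c t).2) (hin t hit htj)
    rw [hboxx, hboxx, hboxx, hboxx] at h4
    obtain ⟨h0, h1, h2, h3⟩ := h4
    refine refFace_of_corners_JF I₀ I₁ J₀ J₁ _ _ h0 ?_ ?_
    · rw [← frame_add_cornerUnit_JF hrot]; exact h1
    · rw [show (cornerOrbit (F.bcBondConfig ω) c t).2 + j + 1 = ((cornerOrbit (F.bcBondConfig ω) c t).2 + 1) + j from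
        add_right_comm _ _ _, ← frame_add_cornerUnit_JF hrot]; exact h2
  -- apply the abstract funnel
  obtain ⟨s, his, hsj, hs⟩ : ∃ s, i ≤ s ∧ s ≤ j' ∧ cornerOrbit β cR s = (v₀, k₀) := by
    refine fence_funnel_JF β N I₀ I₁ J₀ J₁ M hJN hJM hNM v₀ p₁ q₁ k₀ P' Q' hv₀ ?_ ?_ ?_ hp₁y.2 ?_ ?_ ?_
      hq₁y ?_ cR i j' hij hinR ?_
    · -- darts of `P'` inside the box are open after the boundary condition
      intro d hd
      by_cases hbx : (I₀ ≤ d.fst 0 ∧ d.fst 0 ≤ I₁ ∧ J₀ ≤ d.fst 1 ∧ d.fst 1 ≤ J₁) ∧ (I₀ ≤ d.snd 0 ∧ d.snd 0 ≤ I₁ ∧ J₀ ≤ d.snd 1 ∧ d.snd 1 ≤ J₁)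
      · left
        have hdP' := hP'd d hd
        have h1 : d.fst ∈ P.support := P.dart_fst_mem_support_of_mem_darts hdP'
        have h2 : d.snd ∈ P.support := P.dart_snd_mem_support_of_mem_darts hdP'
        have hx := (hbox d.fst).2 hbx.1
        have hy := (hbox d.snd).2 hbx.2
        have hxy : (zdGraph 2).Adj (Ψ.symm d.fst) (Ψ.symm d.snd) := Ψ.symm.map_rel_iff.2 d.adj
        have hedge : s(Ψ.symm d.fst, Ψ.symm d.snd) ∈ F.bcBondConfig ω := by
          rw [DiscreteDobrushin.mem_bcBondConfig_iff]
          refine ⟨(SimpleGraph.mem_edgeSet _).2 ((dom_adj_iff_rect hF hFΩ).2 ⟨hxy, hx, hy⟩), Or.inr ⟨?_, ?_⟩⟩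
          · have := hPω _ (List.mem_map_of_mem (f := SimpleGraph.Dart.edge) hdP')
            rw [show SimpleGraph.Dart.edge d = s(Ψ (Ψ.symm d.fst), Ψ (Ψ.symm d.snd)) by
              rw [RelIso.apply_symm_apply, RelIso.apply_symm_apply]; rfl, mk_mem_relabel_iso_iff] at this
            exact this
          · intro x hx'
            rcases Sym2.mem_iff.1 hx' with rfl | rfl
            · exact hPcol _ h1 hbx.1
            · exact hPcol _ h2 hbx.2
        have := (mk_mem_relabel_iso_iff Ψ (F.bcBondConfig ω) (Ψ.symm d.fst) (Ψ.symm d.snd)).2 hedge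
        rwa [RelIso.apply_symm_apply, RelIso.apply_symm_apply] at this
      · exact Or.inr (not_and_or.1 hbx)
    · intro z hz
      exact (hPreg z (hP's z hz)).1
    · intro z hz
      have hr := (hPreg z (hP's z hz)).2
      rcases mem_support_cases_JF P' hz with ⟨d, hd, rfl⟩ | rfl
      · have := hP'src d hd; omega
      · omega
    · -- edges crossed by `Q'` are closed after the boundary condition
      intro d hd hmem
      have hdQ' := hQ'd d hd
      rw [hβ, BondConfig.mem_relabel_iff, sym2Equiv_symm] at hmem
      obtain ⟨y, hy, hyA⟩ := hQcol d hdQ'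
      rcases (mem_bcBondConfig_cases hF hmem).2.1 with hω | hA
      · apply hQω d hdQ'
        rw [BondConfig.mem_relabel_iff, sym2Equiv_symm]
        exact hω
      · apply hyA
        apply hA
        change Ψ.symm y ∈ Sym2.map Ψ.toEquiv.symm (sepEdge d.fst d.snd)
        exact Sym2.mem_map.2 ⟨y, hy, rfl⟩
    · intro f hf
      exact (hQreg f (hQ's f hf)).1
    · intro f hf
      have hr := (hQreg f (hQ's f hf)).2.1
      rcases mem_support_cases_JF Q' hf with ⟨d, hd, rfl⟩ | rfl
      · have := hQ'src d hd; omega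
      · omega
    · exact hX p₁ hp₁P hp₁ q₁ hq₁Q
    · -- the ends of the stretch
      have hc2 : ∀ t, I₀ ≤ cFace (cornerOrbit β cR t) 0 ∧ cFace (cornerOrbit β cR t) 0 + 1 ≤ I₁ ∧
          J₀ ≤ cFace (cornerOrbit β cR t) 1 ∧ cFace (cornerOrbit β cR t) 1 + 1 ≤ J₁ →
          J₀ ≤ (cornerOrbit β cR t).1 1 := by
        intro t ht
        generalize cornerOrbit β cR t = ct at ht ⊢
        obtain ⟨w, m⟩ := ct
        have := (vertex_coord_JF w m).2.1
        dsimp only at ht ⊢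
        omega
      have hi' := hc2 i (hinR i le_rfl hij)
      have hj'' := hc2 j' (hinR j' hij le_rfl)
      rw [horb] at hi' hj'' ⊢
      rw [horb]
      dsimp only at hi' hj'' ⊢
      obtain ⟨ei0, ei1⟩ := frame_coord_JF hrot ((cornerOrbit (F.bcBondConfig ω) c i).1 - n)
      obtain ⟨ej0, ej1⟩ := frame_coord_JF hrot ((cornerOrbit (F.bcBondConfig ω) c j').1 - n)
      rcases corner_coord_JF j with h | h | h | h <;>
      · simp only [h.1, h.2.1, h.2.2.1, h.2.2.2.1, mul_one, mul_zero, mul_neg, add_zero, zero_add] at ei0 ei1 ej0 ej1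
        rw [ei0, ei1, ej0, ej1]
        rw [ei1] at hi'
        rw [ej1] at hj''
        rcases hends with ⟨h1, h2⟩ | ⟨h1, h2⟩
        · left
          refine ⟨by omega, ?_⟩
          rcases h2 with h2 | h2 <;> rw [le_abs] at h2 <;> omega
        · right
          refine ⟨?_, by omega⟩
          rcases h1 with h1 | h1 <;> rw [le_abs] at h1 <;> omega

  refine ⟨s, his, hsj, ?_⟩
  rw [horb s, Prod.mk.injEq] at hs
  obtain ⟨hs1, hs2⟩ := hs
  rw [← hΨx] at hs1
  rw [Prod.ext_iff]
  dsimp only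
  refine ⟨?_, ?_⟩
  · rw [← hs1, RelIso.symm_apply_apply]
  · simp only [← hs2, add_sub_cancel_right]

end

end Summit.CriticalPhenomena.CardyFormulaZ2.Cruxes.EdgePrecompact.QkzStripBoundaryArm
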